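import Literature.MathematicalPhysics.QuantumLattice.DWaveOrderParameterProofs

/-!
# Sketch (ideator 1, generation 2) — crux `CwChiralConstruction` (stmt-HubbardSuperconductivity-1740)

Support lemma N3 of `Negative-notes/ideator1-g2-remarks.md`: the DIAGONAL STAIRCASE. A floor on the sourced
`d`-wave density along ANY vanishing source sequence `h_L → 0` (one finite-volume family, one liminf) is a floor on the
Koma–Tasaki order parameter `dWaveOrderParameter U μ = liminf_{h→0⁺} liminf_L dWaveSourceDensity (L+1) U μ h`.
(The converse holds up to `ε' < ε` by a diagonal choice `h_L = 1/n` on `[L_n, L_{n+1})`; not formalised here.)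
-/

noncomputable section

set_option linter.dupNamespace false

namespace Summit.HubbardSuperconductivity.HubbardSuperconductivity.Cruxes.CwChiralConstruction.Ideator1g2

open Filter Finset Literature.MathematicalPhysics.QuantumLattice Literature.Probability.LatticeModels
open scoped Topology

/-- **Diagonal staircase (⟸).** For every sequence of source strengths `hs L → 0` (any sign, any rate):
`ε ≤ liminf_L dWaveSourceDensity (L+1) U μ (hs L)` implies `ε ≤ dWaveOrderParameter U μ`.
Proof: for fixed `h > 0` eventually `hs L ≤ h`, so monotonicity of the sourced density in the source
(`dWaveSourceDensity_mono`) bounds every stair `liminf_L dWaveSourceDensity (L+1) U μ h` from below by the diagonal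
liminf, and the stairs floor the order parameter (`le_dWaveOrderParameter_of_forall`). -/
theorem le_dWaveOrderParameter_of_diagonal (U μ ε : ℝ) (hs : ℕ → ℝ)
    (hlim : Tendsto hs atTop (𝓝 0))
    (H : ε ≤ liminf (fun L : ℕ => dWaveSourceDensity (L + 1) U μ (hs L)) atTop) :
    ε ≤ dWaveOrderParameter U μ := by
  refine le_dWaveOrderParameter_of_forall U μ zero_lt_one fun h hh => H.trans ?_
  have hev : ∀ᶠ L : ℕ in atTop,
      dWaveSourceDensity (L + 1) U μ (hs L) ≤ dWaveSourceDensity (L + 1) U μ h := by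
    have hlt : ∀ᶠ L : ℕ in atTop, hs L < h := hlim (Iio_mem_nhds hh.1)
    filter_upwards [hlt] with L hL
    exact dWaveSourceDensity_mono U μ hL.le
  refine liminf_le_liminf hev ?_ ?_
  · exact isBoundedUnder_of_eventually_ge
      (a := -(2 * ∑ e ∈ insert (0 : Site 2) unitSteps, |dWaveFormFactor e / Real.sqrt 2|))
      (Eventually.of_forall fun L => (abs_le.mp (abs_dWaveSourceDensity_le (L + 1) U μ (hs L))).1)
  · exact isCoboundedUnder_ge_of_eventually_le atTop
      (x := 2 * ∑ e ∈ insert (0 : Site 2) unitSteps, |dWaveFormFactor e / Real.sqrt 2|)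
      (Eventually.of_forall fun L => dWaveSourceDensity_le_const _ U μ h)

/-- Corollary in the crux's shape: the order clause `exp(-C/U²) ≤ dWaveOrderParameter U μ` follows from a floor
along one diagonal family `(L, hs L)`, `hs L → 0`. -/
theorem orderClause_of_diagonal (U μ C : ℝ) (hs : ℕ → ℝ) (hlim : Tendsto hs atTop (𝓝 0))
    (H : Real.exp (-C / U ^ 2) ≤ liminf (fun L : ℕ => dWaveSourceDensity (L + 1) U μ (hs L)) atTop) :
    Real.exp (-C / U ^ 2) ≤ dWaveOrderParameter U μ :=
  le_dWaveOrderParameter_of_diagonal U μ _ hs hlim H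

end Summit.HubbardSuperconductivity.HubbardSuperconductivity.Cruxes.CwChiralConstruction.Ideator1g2

end
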